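import Summits.RiemannHypothesis.RiemannHypothesis.Theorems.TiltedLandingLaw421R3Lens1LinkTol

/-!
# TiltedLandingLaw421R3 — lens-1 «MERIDIAN SPLIT» of registry stub 1′ `RhW08.Lens1PinningTol.TopPinningTol (1/10)`: typed statements, exact glue, two rungs

IMAGE «Lens1Meridian» v1 (lens-1 g12; director-rh (CA1201)(3b); landing target `…/Theorems/TiltedLandingLaw421R3Lens1Meridian.lean`, filing by
the lead `--supports stmt-RiemannHypothesis-27010 --as helper`).  SUPPORT, K only: the two law-like items (B1)/(B2) are `def … : Prop` asserted by
nothing; RH is NOT proved; item of record ⟨stmt-RiemannHypothesis-27010⟩ `TiltedLandingLaw421RT` OPEN (route-RiemannHypothesis-EarlyAppointments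
rev 14, line `Cruxes/TiltedLandingLaw421RT/Lines/trkD_v14qRT.lean`, whose stub 1′ is `TopPinningTol (1/10)` verbatim).  ONE import, LANDED (#1309
`…R3Lens1LinkTol`: `phiAt`, `TopPinningTol`, `PinnedTopAt`, `NestedStep`, `NoTallerToucher`, `NLEventOf`, route-A door `stub1'_of_topLinkOrBaseLaw`).

THE OBJECT.  For a simple upper zero `T = x_T + iq` of `G = f^{(j)}` the MERIDIAN is the branch of the pay-level set `{Re φ = 0}` (`φ = G′/G =
phiAt f j`) leaving the pole `T` vertically downward; on a regular arc of `{Re φ = 0}` the tangential derivative of `Im φ` is `±|φ′| ≠ 0`, so `Im φ`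
falls monotonically from `+∞` and the first contact with `{Im φ = 0}` is a zero of `f^{(j+1)}` — non-real in `T`'s closed disc (`NestedStep`) or
real in `T`'s window, approached from `Im φ > 0`, hence Laguerre-violating (`NLEventOf`) — UNLESS the branch first leaves `T`'s closed upper
half-disc through a circle point `m` with `Re φ(m) = 0 < Im φ(m)`: a MERIDIAN EXIT (`MeridianExit`, PATH-FREE data; by Kim (2.3) `m` lies in another
zero's open Jensen disc).  EXIT IDENTITY (`exitIdentity`, PROVED): `|Re(φ(m) − 1/(m−T))|·2q(q − Im m) = |Re m − x_T|`, whence `|Re Ψ(m)| ≥ 1/(2q)`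
at an exit (`exit_re_lower_bound`, PROVED) — exits are cheapest at the feet, impossible near the top.
SPLIT: stub 1′(θ) ⟸ (B1) `MeridianTrichotomyLaw` ∧ (B2) `NoExitOrPartnerLaw θ` (`topPinningTol_of_meridian`, every `θ ≥ 0`, PROVED); RUNG (B3)
`symmetricTopPinningLaw` (PROVED, Rolle on the symmetry axis = the degenerate meridian): an upper zero of an even-or-odd level is pinned AT ITSELF,
touchers allowed — a witness of stub 1′'s conclusion with `a′ = a` outside the isolated regime of `…R3Lens1PinningIso`.
DICTIONARY (C2 g60 ballot criterion, ideators bus l.4413; #1322 «OneMateWinding»): on `T`'s circle the own pair `1/(z−T) + 1/(z−T̄) = 1/(q cos ϑ)`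
is REAL, so C2's nodal points (`Im S_rest = 0`) are where `φ` is real, and the exit points at tilt `g` are the solutions of `γ(ϑ) = g` on the COVERED
sub-arcs (`Im S_rest > 0`), `γ := −1/(q cos ϑ) − Re S_rest`, C2's `g_j = γ(ϑ_j)`, `g_F = γ(π)`; a ballot violation at `g` (`n_L(g) < 0`) ⟺ on some
covered sub-arc the entry tilt is `≥ g >` the next exit-or-foot tilt ⟹ `γ − g` changes sign DOWNWARD there ⟹ a `MeridianExit` (IVT) — NOT conversely:
upward or paired crossings are exits with `n_L ≥ 0` (one not-taller mate, `K_neg`: every `g ∈ (g_1, g_F)`), where the winding pins `T` at itself.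
-/

namespace RhW08.Lens1Meridian

open Complex Set Filter Topology
open scoped ComplexConjugate
open Literature.Analysis.Complex RhIdea6.G17.W07C7 RhIdea6.G17.W07C7.Rev6 RhW08.QuadW RhW08.Lens1Pinning RhW08.Lens1TopChild
open RhW08.Lens1ArcSign RhW08.Lens1PinningTol RhW08.Lens1LinkTol

/-! ## §1 The exit point (path-free data) and the exit identity -/

/-- `m` lies on the OPEN upper arc of `T`'s Jensen circle (centre `Re T`, radius `Im T`), strictly between the feet and the top. -/
def OnUpperCircle (T m : ℂ) : Prop := (m.re - T.re) ^ 2 + m.im ^ 2 = T.im ^ 2 ∧ 0 < m.im ∧ m.im < T.im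

/-- MERIDIAN EXIT at `m`: a point of `T`'s open upper arc at the pay level `Re φ = 0` with `Im φ > 0` (`φ = phiAt f j`) — the only way the
descending pay-level branch from `T` can leave `T`'s closed upper half-disc without producing an event. -/
def MeridianExit (f : ℂ → ℂ) (j : ℕ) (T m : ℂ) : Prop := OnUpperCircle T m ∧ (phiAt f j m).re = 0 ∧ 0 < (phiAt f j m).im

/-- EXIT IDENTITY (pure algebra on the circle): at a pay-level point `m` of `T`'s upper arc the foreign field `Ψ(m) = φ(m) − 1/(m − T)`
satisfies `|Re Ψ(m)|·(2·Im T·(Im T − Im m)) = |Re m − Re T|` (chord identity `‖m − T‖² = 2·Im T·(Im T − Im m)`). -/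
def ExitIdentity : Prop := ∀ (T m φ : ℂ), OnUpperCircle T m → φ.re = 0 → |(φ - 1 / (m - T)).re| * (2 * T.im * (T.im - m.im)) = |m.re - T.re|

/-- (K) the exit identity holds. -/
theorem exitIdentity : ExitIdentity := by
  intro T m φ ⟨hcirc, hpos, hlt⟩ hφ
  have hD : 0 < 2 * T.im * (T.im - m.im) := mul_pos (mul_pos two_pos (hpos.trans hlt)) (sub_pos.mpr hlt)
  have hns : Complex.normSq (m - T) = 2 * T.im * (T.im - m.im) := by
    rw [Complex.normSq_apply, Complex.sub_re, Complex.sub_im]; linear_combination hcirc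
  have hre : (φ - 1 / (m - T)).re = -((m.re - T.re) / (2 * T.im * (T.im - m.im))) := by
    rw [Complex.sub_re, hφ, one_div, Complex.inv_re, hns, Complex.sub_re]; ring
  rw [hre, abs_neg, abs_div, abs_of_pos hD, div_mul_cancel₀ _ hD.ne']

/-- (K) at an exit the foreign field has `|Re Ψ(m)| ≥ 1/(2·Im T)` (`|Re m − Re T|² = (Im T − Im m)(Im T + Im m) ≥ (Im T − Im m)²`). -/
theorem exit_re_lower_bound {T m φ : ℂ} (hm : OnUpperCircle T m) (hφ : φ.re = 0) : 1 / (2 * T.im) ≤ |(φ - 1 / (m - T)).re| := by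
  obtain ⟨hid, hcirc, hpos, hlt⟩ := And.intro (exitIdentity T m φ hm hφ) hm
  have hle : T.im - m.im ≤ |m.re - T.re| := by nlinarith [abs_nonneg (m.re - T.re), sq_abs (m.re - T.re), hcirc, hpos.le, hlt.le]
  rw [div_le_iff₀ (mul_pos two_pos (hpos.trans hlt))]
  refine le_of_mul_le_mul_left ?_ (sub_pos.mpr hlt)
  calc (T.im - m.im) * 1 = T.im - m.im := mul_one _
    _ ≤ |m.re - T.re| := hle
    _ = (T.im - m.im) * (|(φ - 1 / (m - T)).re| * (2 * T.im)) := by rw [← hid]; ring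

/-! ## §2 The split of stub 1′ -/

/-- (B1) ★ MERIDIAN TRICHOTOMY — TYPED OPEN LAW, asserted by nothing (believed true unconditionally; proof plan = the pay-ray lift: local structure of
`{Re φ = 0}` at the simple pole `T` (vertical tangent), at regular points and at the finitely many critical points of `φ` in the compact half-disc,
`Im φ` strictly monotone on regular arcs; HEAVY — Mathlib has no ready level-curve / path-lifting lemma): on a legal frame, a SIMPLE upper zero `T` of
`f^{(j)}` is pinned AT ITSELF (`PinnedTopAt f j T`) or has a meridian exit point (`∃ m, MeridianExit f j T m`).  Float tracer `meridian1.py`–`meridian4.py`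
agrees with the exact critical points (`pincheck`) on every census row (NEG-16: EXIT; all else BASE/NEST). -/
def MeridianTrichotomyLaw : Prop :=
  ∀ (η : ℝ) (f : ℂ → ℂ) (x₀ s hmax R Hs : ℝ) (B : ℕ), EngineHyps5 2 η f x₀ s hmax R Hs B → ∀ (j : ℕ) (T : ℂ),
    iteratedDeriv j f T = 0 → 0 < T.im → iteratedDeriv (j + 1) f T ≠ 0 → PinnedTopAt f j T ∨ ∃ m : ℂ, MeridianExit f j T m

/-- (B2) ★ NO-EXIT-OR-PARTNER — TYPED OPEN RESIDUAL, asserted by nothing (UNDECIDED; the combinatorial residual the benches hunt): on a legal frame, a top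
with no strictly taller toucher which HAS a meridian exit point still has a pinned zero in its `θ`-band — `TopPinningTol θ`'s conclusion VERBATIM under
the extra path-free binder `∃ m, MeridianExit f j T m`.  KEEP number: legal (frame, top) with an exit point and NO pinned admissible `θ`-partner = 0 /
(1 260 silencer rows + 133 controls + 3 157 one-toucher cells + 222 × 1 402 corner/thief tilts; C2: 0 ballot violations / 68 604 + 262 496 frames); the
only unpinned top seen is NEG-16's (corner leak, tilt width ≈ 3·10⁻⁶), whose equal-height partner is pinned.  KILL number: 1 legal frame (exact). -/
def NoExitOrPartnerLaw (θ : ℝ) : Prop :=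
  ∀ (η : ℝ) (f : ℂ → ℂ) (x₀ s hmax R Hs : ℝ) (B : ℕ), EngineHyps5 2 η f x₀ s hmax R Hs B → ∀ (j : ℕ) (T : ℂ),
    iteratedDeriv j f T = 0 → 0 < T.im → NoTallerToucher f j T → (∃ m : ℂ, MeridianExit f j T m) →
    ∃ a' : ℂ, iteratedDeriv j f a' = 0 ∧ (1 - θ) * T.im ≤ a'.im ∧ a'.im ≤ T.im ∧ |T.re - a'.re| ≤ T.im + a'.im ∧ PinnedTopAt f j a'

/-- (K) ★ EXACT GLUE: (B1) ∧ (B2)(θ) ⇒ stub 1′(θ) `TopPinningTol θ` for every `θ ≥ 0` (a multiple zero `T` of `f^{(j)}` is a nested critical point of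
itself; else (B1) pins `T` at itself or produces an exit point, which (B2) consumes). -/
theorem topPinningTol_of_meridian {θ : ℝ} (hθ : 0 ≤ θ) (h1 : MeridianTrichotomyLaw) (h2 : NoExitOrPartnerLaw θ) : TopPinningTol θ := by
  intro η f x₀ s hmax R Hs B hE j a ha hpos hnt
  have self : PinnedTopAt f j a →
      ∃ a' : ℂ, iteratedDeriv j f a' = 0 ∧ (1 - θ) * a.im ≤ a'.im ∧ a'.im ≤ a.im ∧ |a.re - a'.re| ≤ a.im + a'.im ∧ PinnedTopAt f j a' :=
    fun hp => ⟨a, ha, by nlinarith [mul_nonneg hθ hpos.le], le_rfl, by rw [sub_self, abs_zero]; linarith, hp⟩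
  by_cases hcrit : iteratedDeriv (j + 1) f a = 0
  · exact self (Or.inl ⟨a, hcrit, ne_of_gt hpos, by unfold NestedStep; simp⟩)
  · rcases h1 η f x₀ s hmax R Hs B hE j a ha hpos hcrit with hp | hex
    exacts [self hp, h2 η f x₀ s hmax R Hs B hE j a ha hpos hnt hex]

/-- (K) the two doors to stub 1′ on file: route A (#1309, `TopLinkOrBaseLawQ (1/10)`) and route B (this module, the typed line of record, (CA1201)(3)). -/
theorem stub1'_routes : (TopLinkOrBaseLawQ (1 / 10) → TopPinningTol (1 / 10)) ∧
    (MeridianTrichotomyLaw → NoExitOrPartnerLaw (1 / 10) → TopPinningTol (1 / 10)) :=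
  ⟨stub1'_of_topLinkOrBaseLaw, fun h1 h2 => topPinningTol_of_meridian (by norm_num) h1 h2⟩

/-! ## §3 The symmetric rung (meridian = axis), PROVED -/

/-- (B3) SYMMETRIC-TOP PINNING LAW (NO toucher / isolation / finiteness hypothesis): if `f` is entire and real on `ℝ` and `f^{(j)}` is even or odd
about the vertical line through its upper zero `T`, then `T` is pinned at itself (`PinnedTopAt f j T`). -/
def SymmetricTopPinningLaw : Prop :=
  ∀ (f : ℂ → ℂ) (j : ℕ) (T : ℂ), Differentiable ℂ f → (∀ x : ℝ, (f x).im = 0) → iteratedDeriv j f T = 0 → 0 < T.im →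
    ((∀ z : ℂ, iteratedDeriv j f (2 * (T.re : ℂ) - z) = iteratedDeriv j f z) ∨ (∀ z : ℂ, iteratedDeriv j f (2 * (T.re : ℂ) - z) = -iteratedDeriv j f z)) →
    PinnedTopAt f j T

/-- (K) real engine (Rolle after a second-order start): `h q = 0`, and at `0` either `h 0 = 0` or a critical point with `h·h″ > 0`, give a
critical point of `h` strictly between `0` and `q` (slope limit ⇒ `h·h′ > 0` just right of `0` ⇒ MVT ⇒ IVT back to the level `h 0` ⇒ Rolle). -/
theorem exists_crit_Ioo {h h₁ : ℝ → ℝ} {h₂ q : ℝ} (hq : 0 < q) (hd : ∀ y, HasDerivAt h (h₁ y) y) (hd2 : HasDerivAt h₁ h₂ 0)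
    (hq0 : h q = 0) (h0 : h 0 = 0 ∨ (h₁ 0 = 0 ∧ 0 < h 0 * h₂)) : ∃ y, 0 < y ∧ y < q ∧ h₁ y = 0 := by
  have hc : Continuous h := continuous_iff_continuousAt.mpr fun y => (hd y).continuousAt
  suffices key : ∃ y₂, 0 < y₂ ∧ y₂ ≤ q ∧ h y₂ = h 0 by
    obtain ⟨y₂, hy₂, hy₂q, hy⟩ := key
    obtain ⟨c, hc, hc0⟩ := exists_hasDerivAt_eq_zero hy₂ hc.continuousOn hy.symm (fun y _ => hd y)
    exact ⟨c, hc.1, lt_of_lt_of_le hc.2 hy₂q, hc0⟩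
  rcases h0 with h0 | ⟨h10, hpos⟩
  · exact ⟨q, hq, le_rfl, by rw [hq0, h0]⟩
  have h0ne : h 0 ≠ 0 := fun h00 => by rw [h00, zero_mul] at hpos; exact lt_irrefl _ hpos
  have hev : ∀ᶠ y in 𝓝[≠] (0:ℝ), 0 < h 0 * slope h₁ 0 y :=
    ((hasDerivAt_iff_tendsto_slope.mp hd2).const_mul (h 0)).eventually (lt_mem_nhds hpos)
  obtain ⟨δ, hδ, hδp⟩ := Metric.eventually_nhds_iff.mp (eventually_nhdsWithin_iff.mp hev)
  obtain ⟨y₁, hy₁pos, hy₁δ, hy₁q⟩ : ∃ y₁ : ℝ, 0 < y₁ ∧ y₁ < δ ∧ y₁ < q := ⟨min (δ / 2) (q / 2), lt_min (by linarith) (by linarith),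
    lt_of_le_of_lt (min_le_left _ _) (by linarith), lt_of_le_of_lt (min_le_right _ _) (by linarith)⟩
  obtain ⟨c, hcI, hceq⟩ := exists_hasDerivAt_eq_slope h h₁ hy₁pos hc.continuousOn (fun y _ => hd y)
  have hsl := hδp (y := c) (by rw [Real.dist_eq, sub_zero, abs_of_pos hcI.1]; exact hcI.2.trans hy₁δ) (ne_of_gt hcI.1)
  rw [slope_def_field, h10, sub_zero, sub_zero, hceq, sub_zero] at hsl
  have hgt : h 0 * h 0 < h 0 * h y₁ := by
    have e : h 0 * ((h y₁ - h 0) / y₁ / c) * c * y₁ = h 0 * h y₁ - h 0 * h 0 := by field_simp [ne_of_gt hcI.1, ne_of_gt hy₁pos]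
    nlinarith [mul_pos (mul_pos hsl hcI.1) hy₁pos]
  have hK : ContinuousOn (fun y => h 0 * h y) (Icc y₁ q) := (continuous_const.mul hc).continuousOn
  obtain ⟨y₂, hy₂, hy₂eq⟩ := intermediate_value_Icc' hy₁q.le hK ⟨by simp only [hq0, mul_zero]; exact mul_self_nonneg _, hgt.le⟩
  exact ⟨y₂, lt_of_lt_of_le hy₁pos hy₂.1, hy₂.2, mul_left_cancel₀ h0ne hy₂eq⟩

/-- (K) ★ (B3) holds.  On the axis `z = Re T + iy` reflection + Schwarz give `conj f^{(j+1)} = ∓f^{(j+1)}`; the real function `y ↦ Re f^{(j)}` (even) /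
`y ↦ Re(i·f^{(j)})` (odd) vanishes at `y = Im T`; even: `f^{(j+1)}(Re T) = 0`, so either the NL test passes at `Re T` or `exists_crit_Ioo` applies. -/
theorem symmetricTopPinningLaw : SymmetricTopPinningLaw := by
  intro f j T hf hreal hT hq hsym
  have hS := Literature.NumberTheory.LFunctions.iteratedDeriv_conj_of_conj (apply_conj_eq_conj hf hreal)
  have hD := differentiable_iteratedDeriv_of_entire hf
  set a : ℝ := T.re with ha
  set q : ℝ := T.im with hqd
  have hTeq : (a : ℂ) + I * (q : ℂ) = T := by rw [mul_comm]; exact re_add_im T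
  have hcomp : ∀ (n : ℕ) (z : ℂ), HasDerivAt (fun z => iteratedDeriv n f ((a : ℂ) + I * z)) (iteratedDeriv (n + 1) f ((a : ℂ) + I * z) * I) z := by
    intro n z
    have hlin : HasDerivAt (fun z : ℂ => (a : ℂ) + I * z) I z := by simpa using ((hasDerivAt_id z).const_mul I).const_add (a : ℂ)
    rw [iteratedDeriv_succ]; exact (hD n _).hasDerivAt.comp z hlin
  obtain ⟨ε, hε, hsym'⟩ : ∃ ε : ℂ, (ε = 1 ∨ ε = -1) ∧ ∀ z, iteratedDeriv j f (2 * (a : ℂ) - z) = ε * iteratedDeriv j f z := by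
    rcases hsym with h | h
    · exact ⟨1, Or.inl rfl, fun z => by rw [h, one_mul]⟩
    · exact ⟨-1, Or.inr rfl, fun z => by rw [h, neg_one_mul]⟩
  have hR1 : ∀ z, iteratedDeriv (j + 1) f (2 * (a : ℂ) - z) = -(ε * iteratedDeriv (j + 1) f z) := fun z => by
    have h : deriv (fun z => iteratedDeriv j f (2 * (a : ℂ) - z)) z = deriv (fun z => ε * iteratedDeriv j f z) z := by
      rw [show (fun z => iteratedDeriv j f (2 * (a : ℂ) - z)) = (fun z => ε * iteratedDeriv j f z) from funext hsym']
    rw [deriv_comp_const_sub (iteratedDeriv j f), deriv_const_mul ε (hD j z)] at h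
    rw [iteratedDeriv_succ]; linear_combination -h
  have hax : ∀ y : ℝ, conj ((a : ℂ) + I * y) = 2 * (a : ℂ) - ((a : ℂ) + I * y) := fun y => by apply Complex.ext <;> simp [two_mul]
  have haxis : ∀ y : ℝ, conj (iteratedDeriv (j + 1) f ((a : ℂ) + I * y)) = -(ε * iteratedDeriv (j + 1) f ((a : ℂ) + I * y)) :=
    fun y => by rw [← hS, hax, hR1]
  have hreal' : ∀ (n : ℕ), (iteratedDeriv n f (a : ℂ)).im = 0 := fun n => by
    have := hS n a; rw [conj_ofReal] at this; exact conj_eq_iff_im.mp this.symm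
  have hTq : iteratedDeriv j f ((a : ℂ) + I * (q : ℂ)) = 0 := by rw [hTeq, hT]
  rcases hε with rfl | rfl
  · have hre0 : ∀ y : ℝ, (iteratedDeriv (j + 1) f ((a : ℂ) + I * y)).re = 0 := fun y => by
      have := congrArg Complex.re (haxis y); simp at this; linarith
    have hGa : iteratedDeriv (j + 1) f (a : ℂ) = 0 := by apply Complex.ext <;> [simpa using hre0 0; simpa using hreal' (j + 1)]
    by_cases hNL : (iteratedDeriv j f (a : ℂ)).re ≠ 0 ∧ 0 ≤ (iteratedDeriv j f (a : ℂ)).re * (iteratedDeriv (j + 2) f (a : ℂ)).re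
    · exact Or.inr ⟨a, by rw [← ha, ← hqd, sub_self, abs_zero]; exact hq.le, by rw [hGa, zero_re], hNL.1, hNL.2⟩
    have hd0 : ∀ y : ℝ, HasDerivAt (fun y : ℝ => (iteratedDeriv j f ((a : ℂ) + I * y)).re)
        (iteratedDeriv (j + 1) f ((a : ℂ) + I * y) * I).re y := fun y => (hcomp j y).real_of_complex
    have hd1 : ∀ y : ℝ, HasDerivAt (fun y : ℝ => (iteratedDeriv (j + 1) f ((a : ℂ) + I * y) * I).re)
        (iteratedDeriv (j + 2) f ((a : ℂ) + I * y) * I * I).re y := fun y => ((hcomp (j + 1) y).mul_const I).real_of_complex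
    obtain ⟨y, hy0, hyq, hy⟩ := exists_crit_Ioo hq hd0 (hd1 0) (by simpa using congrArg Complex.re hTq) (by
      push Not at hNL
      by_cases hz : (iteratedDeriv j f (a : ℂ)).re = 0
      · left; simpa using hz
      · refine Or.inr ⟨by simp [hGa], ?_⟩
        have := hNL hz; simp; nlinarith)
    refine Or.inl ⟨(a : ℂ) + I * y, ?_, by simpa using ne_of_gt hy0, by unfold NestedStep; simp; nlinarith⟩
    apply Complex.ext <;> [simpa using hre0 y; simpa using hy]
  · have him0 : ∀ y : ℝ, (iteratedDeriv (j + 1) f ((a : ℂ) + I * y)).im = 0 := fun y => by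
      have := haxis y; rw [neg_mul, one_mul, neg_neg] at this; exact conj_eq_iff_im.mp this
    have hd0 : ∀ y : ℝ, HasDerivAt (fun y : ℝ => (iteratedDeriv j f ((a : ℂ) + I * y) * I).re)
        (iteratedDeriv (j + 1) f ((a : ℂ) + I * y) * I * I).re y := fun y => ((hcomp j y).mul_const I).real_of_complex
    have hd1 : ∀ y : ℝ, HasDerivAt (fun y : ℝ => (iteratedDeriv (j + 1) f ((a : ℂ) + I * y) * I * I).re)
        (iteratedDeriv (j + 2) f ((a : ℂ) + I * y) * I * I * I).re y := fun y => (((hcomp (j + 1) y).mul_const I).mul_const I).real_of_complex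
    obtain ⟨y, hy0, hyq, hy⟩ := exists_crit_Ioo hq hd0 (hd1 0) (by simp [hTq]) (Or.inl (by simpa using hreal' j))
    refine Or.inl ⟨(a : ℂ) + I * y, ?_, by simpa using ne_of_gt hy0, by unfold NestedStep; simp; nlinarith⟩
    apply Complex.ext <;> [simpa using hy; simpa using him0 y]

end RhW08.Lens1Meridian
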